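import Literature.NumberTheory.EllipticCurves.BertoliniLongoVenerucci2026.IndefiniteMainConjectureSupersingularBDP
import HarnessLib

/-!
# Castella–Hsu–Kundu–Lee–Liu 2025, Thm. 7.1 / Cor. 7.2: the ± Heegner point main conjecture and the
# Iwasawa–Greenberg (BDP) anticyclotomic main conjecture for SEMISTABLE-type conductors at a good
# supersingular prime split in `K`, classical Heegner hypothesis — read as the EISENSTEIN half of
# Castella–Wan's statement 5.2, `char_{Λac}(X^{rel,str})Λ^ur ⊂ (L_p^BDP)`, up to a power of `p`;
# ONE statement-only named fact

Topic `Literature/NumberTheory/EllipticCurves`; namespace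
`Literature.NumberTheory.EllipticCurves.CastellaHsuKunduLeeLiu2025`.  HONEST FRAMING: a `def … : Prop`
(D-0014; nothing asserted, no `_holds`, no `sorry`), hypotheses AS PRINTED with the restrictions
(R1)–(R6) below — each making the typed statement WEAKER than print —, page locators on the arXiv v2
text `paper:arxiv-2308.10474` (= the published version, Trans. Amer. Math. Soc. Ser. B 12 (2025)
748–788; per-page files `pNNNN`); the conclusion is written in EXACTLY the currency of the tree's
`BertoliniLongoVenerucci2026.thmA_castellaWan_thm68_exists_isCWBDPLFunction_charIdeal_map_le_rat` and
`CastellaWan2024.charIdeal_map_le_rat_of_thm53` (the same divisibility on other cells), so that the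
consumers of those facts consume this one verbatim.  Typed ≠ proved ≠ endorsed; BSD is not advanced
by this file.

WHY (consumer by name). The BSD summit's route `SignedBaseChange`, crux
`AnticyclotomicEisensteinDivisibility` (stmt-BirchSwinnertonDyer-20727), line `bdpline`: its derived
statement S1 (`stub_bdpLowerHalfRatSS`) = the RATIONAL Eisenstein half of the BDP anticyclotomic main
conjecture at a good supersingular `p ≥ 5`, `ρ̄` surjective, classical Heegner field, ANY conductor, is
closed on the all-additive cell by the Bertolini–Longo–Venerucci fact and is a registered RESEARCH stub
(`stub_signedEisensteinSS_coprime`) whenever some prime divides `N` exactly once.  The source read here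
closes the SEMISTABLE slice of that cell — `N` square-free with `E[p]` ramified at every `ℓ ∣ N` — in
refereed print (2025).  The crux-side glue lives under `Summits/`.

## Source, VERBATIM (locators)

[CastellaEtAl2025] F. Castella, C.-Y. Hsu, D. Kundu, Y.-S. Lee, Z. Liu, *Derived `p`-adic heights and
the leading coefficient of the Bertolini–Darmon–Prasanna `p`-adic `L`-function*, Trans. Amer. Math.
Soc. Ser. B 12 (2025) 748–788, doi:10.1090/btran/227 = arXiv:2308.10474v2 [CastellaEtAl2023].

* §7.1 SETTING [p0029 L3–L27]: "Let `E/ℚ` be an elliptic curve of conductor `N`, and let `p > 2` be a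
  prime of good supersingular reduction for `E`. We assume that (non-ord) `a_p(E) = 0` (which by the
  Hasse bounds is automatic for `p > 3`). Let `K` be an imaginary quadratic field of discriminant
  prime to `N` such that (spl) `p = 𝔭𝔭̄` splits in `K`. Writing `N = N⁺N⁻` with `N⁺` (resp. `N⁻`)
  divisible only by primes that split (resp. remain inert) in `K`, assume the following generalised
  Heegner hypothesis: (gen-Heeg) `N⁻` is the square-free product of an even number of primes. … an
  analogue of Perrin-Riou's Heegner point main conjecture [PR87] was formulated in [CW24, Conj. 4.8].
  Letting `𝒮_±` and `𝒳_±` be the compact Selmer groups over `K_∞/K` denoted by `Sel_±(K, T^ac)` and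
  `Sel_±(K, A^ac)^∨` in [CW24, §4.2], respectively, the conjecture predicts that both `𝒮_±` and `𝒳_±`
  have `Λ`-rank one, with the characteristic ideal of the `Λ`-torsion submodule `𝒳_{±,tors} ⊂ 𝒳_±`
  being the same as `char_Λ(𝒮_±/(κ^±_∞))²` for the `Λ`-adic `±`-Heegner class (7.1) `κ^±_∞ ∈ 𝒮_±`
  constructed in [CW24, §4.1] (where it is denoted `z^±_∞ = cor_{K[1]/K}(z_∞[1]^±)`)."
* **Theorem 7.1** [p0029 L28–L37]: "Let `(E, K, p)` be a triple as above, and assume in addition that: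
  (i) `N` is square-free. (ii) `E[p]` is ramified at every prime `ℓ ∣ N⁺`. (iii) `E[p]` is ramified
  at every prime `ℓ ∣ N⁻` with `ℓ ≡ ±1 (mod p)`. (iv) Every prime above `p` is totally ramified in
  `K_∞/K`. Then `𝒮_±` and `𝒳_±` have `Λ`-rank one, and `char_Λ(𝒳_{±,tors}) = char_Λ(𝒮_±/(κ^±_∞))²`.
  In other words, the `±`-Heegner point main conjecture in [CW24, Conj. 4.8] holds."
* **Corollary 7.2** [p0029 L38–L42]: "Let the hypotheses be as in Theorem 7.1. Then [CW24, Conj. 5.2]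
  holds. In particular, in the case `N⁻ = 1`, Conjecture 2.4 in the body of the paper holds. Proof.
  This follows from Theorem 7.1 and the equivalence in [CW24, Thm. 6.8], noting that Conjecture 2.4
  is the same as [CW24, Conj. 5.2] when `N⁻ = 1`."
* §7.2, Condition CR [p0029 L47–L51]: "we say that the pair `(ρ̄, N⁻)` satisfies Condition CR if:
  `ρ̄` is ramified at every prime `ℓ ∣ N⁻` with `ℓ ≡ ±1 (mod p)`, and `ρ̄` is surjective" (footnote:
  "It follows from [Edi97, Prop. 2.1] that if `E` is semistable and `p` is supersingular for `E`, then
  `ρ̄` is surjective"); §7 opening [p0028 L52–L60]: "The purpose of this section is to give a proof of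
  the signed Heegner point main conjecture formulated in [CW24] for supersingular primes `p` under mild
  hypotheses. By the equivalence between this conjecture and Conjecture 2.4 when `p = 𝔭𝔭̄` splits in
  `K`, we deduce a proof of the latter conjecture under the same hypotheses. … To obtain a result under
  (Heeg), here we adapt the approach of [BCK21] to the supersingular setting."  Abstract / Thm. 1.6
  [p0001, p0005 L4–L17]: "by adapting the approach of Burungale–Castella–Kim [BCK21], we prove the main
  conjecture for supersingular primes `p` under mild hypotheses" / "Theorem 1.6. Let `p > 2` be a prime
  of good supersingular reduction for `E`, and let `K` be an imaginary quadratic field satisfying (Heeg)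
  and (spl). Assume in addition that: (i) `N` is square-free. (ii) `E[p]` is ramified at every prime
  `ℓ ∣ N⁺`. (iii) … (iv) Every prime above `p` is totally ramified in `K_∞/K`. Then `X_𝔭` is
  `Λ`-torsion, with `char_Λ(X_𝔭) = (L_p^BDP)`. In other words, the Iwasawa–Greenberg Main Conjecture
  (1.2) holds."  §1.1 [p0001–p0002]: (Heeg) "every prime factor of `N` splits in `K`", (spl)
  "`p = 𝔭𝔭̄` splits in `K`", "`𝓛_p^BDP ∈ Λ_𝒪̂` whose square `L_p^BDP = (𝓛_p^BDP)²` interpolates central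
  critical values".
* [CastellaWan2023] Castella–Wan, Math. Ann. 389 (2024), accepted MS `paper:url-7157bd4f7b88`:
  **5.2** (MS p. 23): "`X^{rel,str}` is `Λ^ac`-torsion, and `char_{Λac}(X^{rel,str})Λ^ur = (L_p^BDP)`";
  Def. 5.1 (MS p. 23), Prop. 2.1 / (2.2) (MS pp. 5–8: `L_p^BDP = (𝓛_𝔭^BDP)²`, the characterisation
  `IsCWBDPLFunction`), Thm. 6.8 (MS pp. 29–31).

## READING typed here (one refereed source; its own corollary)

Cor. 7.2 at `N⁻ = 1` gives Castella–Wan's 5.2 in full: `X^{rel,str}` is `Λ^ac`-torsion and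
`char_{Λac}(X^{rel,str})Λ^ur = (L_p^BDP)`.  Tree orientation EXACTLY as restriction (R5) of
`CastellaWan2024/GreenbergMainConjectureBDP.lean` and (R6) of the Bertolini–Longo–Venerucci fact (flag
`CW24-53-orientation-L33`): the typed `L` is `ι_Λ(u · L_p^BDP)` characterised by `IsCWBDPLFunction ι 𝔭`,
and its partner is the PRECOMPOSITION dual `AcSelmer.XAc (W⁄K) p κ 𝔭̄ ∅ γ` (strict at `𝔭̄ ∋ p`,
`𝔭̄ ≠ 𝔭`) = Def. 5.1's `X^{rel,str}` by Shapiro.  Only the inclusion `char ⊆ (L)`, rationally, is kept.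

## RESTRICTIONS of the transcription (each makes the typed statement WEAKER than print)

(R1) `5 ≤ p` (print: `p > 2`), `p` good with `a_p = 0`, `p = 𝔭𝔭̄` SPLIT in `K`, `𝔭` the prime
induced by the embedding datum `ι` (binder as in the Castella–Wan facts), `𝔭̄ ∋ p`, `𝔭̄ ≠ 𝔭`.
-- TODO(general form): `p = 3` with `a_3 = 0`.
(R2) `N⁻ = 1`: EVERY prime `ℓ ∣ N` has two primes of `K` above it (then (gen-Heeg), hypothesis
(iii) and the `N⁻`-part of Condition CR are vacuous); `(N, D_K) = 1` kept verbatim ("discriminant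
prime to `N`"). -- TODO(general form): `N⁻ ≠ 1` with an even number of inert primes.
(R3) `ρ̄_{E,p}` SURJECTIVE (`Rank1Residual.Surj`) kept as an explicit hypothesis (print: second
bullet of Condition CR, automatic for semistable `E` at supersingular `p` by [Edi97]).
(R4) Hypotheses (i) and (ii) of Thm. 7.1 VERBATIM: `Squarefree N`, and "`E[p]` is ramified at every
prime `ℓ ∣ N⁺ (= N)`" in the tree's currency of `BertoliniLongoVenerucci2026.RevisedHypothesis` item
(6) ("`ρ̄_{E,p}` is ramified at `q`"): for every prime `q ∣ N` there are a finite place `v ∋ q` of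
`ℚ`, a prime `𝔓` of `ℚ̄` above `v`, `σ` in the inertia group of `𝔓` and `P ∈ E[p]` with `σ·P ≠ P`.
(For square-free `N` and `p ≥ 5` this says `p ∤ ord_q(Δ_E)` at every (multiplicative) `q ∣ N`.)
(R5) Hypothesis (iv) "every prime above `p` is totally ramified in `K_∞/K`" is typed as
`p ∤ h_K` (`NumberField.classNumber`), flag `tot-ram-via-h_K` of the Castella–Wan files: for the
ANTICYCLOTOMIC `ℤ_p`-extension the two inertia subgroups at `𝔭`, `𝔭̄` coincide (complex conjugation
normalises `Γ` and swaps them; subgroups of `ℤ_p` are characteristic) and their common fixed field is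
an unramified abelian `p`-power extension of `K`, trivial when `p ∤ h_K` — so `p ∤ h_K` IMPLIES (iv)
and the typed statement is weaker than print; `κ` the anticyclotomic `ℤ_p`-extension with a
topological generator `γ`; `W` a global minimal model with newform `f` of level `N = N_E`.
(R6) CONCLUSION in RATIONAL form and with an EXISTENTIAL frame, byte-parallel to the
Bertolini–Longo–Venerucci fact and to `CastellaWan2024.charIdeal_map_le_rat_of_thm53`: there is a
frame `(Ω_K ≠ 0, Ω_p ∈ R₀ˣ, L ∈ R₀⟦T⟧)` with `IsCWBDPLFunction ι 𝔭 κ γ f D_K Ω_K Ω_p L` such that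
along every structure map `j : ℤ_p → R₀` compatible with `ℤ_p ⊂ ℂ_p` there is `k` with
`p^k · char_Λ(X_ac strict at 𝔭̄)·R₀⟦T⟧ ⊆ (L)`.  Print gives the INTEGRAL EQUALITY
`char_{Λac}(X^{rel,str})Λ^ur = (L_p^BDP)`, the torsion of `X^{rel,str}`, and the `±` Heegner point
main conjecture itself (ranks one, `char(𝒳_{±,tors}) = char(𝒮_±/(κ^±_∞))²`); none of these is
recorded. -- TODO(general form): the integral equality, the torsion clause, Thm. 7.1 in the `±`
currency of `AcSigned`.

## READING / RELIABILITY FLAGS (informational)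

* `CHKLL-inputs`: the printed proof (§7.2–7.4) runs Howard's bipartite-Euler-system criterion with:
  the `±` bipartite Euler system of Darmon–Iovita / Pollack–Weston (Thm. 7.4, [DI08], [PW11] §4.3
  under Condition CR), W. Zhang's proof of Kolyvagin's conjecture [Zha14] with the refinements of
  [BCK21], and Castella–Wan [CW24] (§4, Lemma 6.7, Thm. 6.8; standing `p > 3` there).  All are
  refereed; the source is a refereed journal article (2025).  Hypotheses (i)–(iv) are those under
  which these inputs are printed (square-free level for [PW11]/[DI08]; CR for the level raising).
* `tot-ram-via-h_K` (R5), `CW24-53-orientation-L33`, `CW24-local-condition`, `heegner-normalisation`: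
  inherited from the Castella–Wan files; the `p^k` of (R6) absorbs the normalisations.

## NOT typed here (and why)

Thm. 7.1 in the signed currency (`AcSigned.selmerLambdaAdic`, `AcSigned.X`, the class `z^±_∞`):
the consumer needs the BDP currency only, and the signed statement needs the pinned Heegner class of
`AcSigned.castellaWan2024_prop44_exists_signedHeegnerClass`; Thm. 1.5 (leading coefficient), Thm. 1.6
for `N⁻ ≠ 1`, the `p`-converse (Cor. 1.x): not needed by the consumer.
## ADDENDUM (literature-typer row `bsd-ssimc-ty-acsignedGeneral`, director-bsd (424)D, 2026-08-29): two more
## statement-only named facts from the SAME refereed source, on the SAME tree objects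

WHY (consumers by name). (a) `prop25_XAc_isTorsion` = **Prop. 2.5** (supersingular branch) is the print
behind the SHARED registered stub `stub_xAcTorsionSS_classDvd` ("TS1 ∣ {p ∣ h_K}") of the lines
`Lines/ratlift.lean` (crux `TwoVariableEulerSystemDivisibility`, stmt-BirchSwinnertonDyer-20728) and
`Lines/admdef.lean` (crux `AnticyclotomicEisensteinDivisibility`, stmt-BirchSwinnertonDyer-20727): the
tree glue `TS1Shape.xAcTorsionSS_classDvd_of_prop25` (`Cruxes/TwoVariableEulerSystemDivisibility/Lines/
ratlift_ts1shape.lean`) closes that stub from `(h : prop25_XAc_isTorsion)` verbatim, at ANY conductor and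
ANY class number (Prop. 2.5 prints neither a square-free nor a class-number hypothesis).  (b)
`thm71_cor72_isTorsion_charIdeal_map_eq` = **Cor. 7.2 in full at `N⁻ = 1`** (torsion AND the INTEGRAL
equality of [CW24, Conj. 5.2]) executes this file's own `-- TODO(general form): the integral equality and
the torsion clause of 5.2`; it REFINES the rational fact above (proved: `thm71_cor72_le_rat_of_eq`, `k = 0`),
so no consumer of the `_rat` fact can break; consumer: `Ratlift.howardIntegralSS_cellA_of_cor72IntegralEulerHalf`
(HOW ∣ cell A on 20728).  Nothing here is proved or endorsed; BSD is not advanced by this file.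

* **Proposition 2.5** [p0008 L17–L28], VERBATIM: "The first claim in Conjecture 2.4 is now known under a
  mild hypothesis.  Proposition 2.5. Assume (h0). Then `Sel_q(K_∞, W)` is `Λ`-cotorsion.  Proof. In the
  `p`-ordinary case, this follows from [CGLS22, Thm. 4.2.2] and [CGS23, Thm. 5.53]. Note that the proof
  of these results is based on Kolyvagin's methods applied to the anticyclotomic Euler system of Heegner
  points on `E/K` and a `Λ`-adic extension of the formula (BDP) of Bertolini–Darmon–Prasanna obtained in
  [CH18a, Thm. 5.1]. For supersingular primes `p` (and assuming `a_p = 0` when `p = 3`), the result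
  similarly follows from an adaptation of the argument in [CGLS22, Thm. 3.4.1] applied to (signed)
  Heegner point Kolyvagin system constructed in [CW24, Thm. A.4] (which is non-trivial by [CW24, Cor.
  6.4] and in a similar relation to `L_q^BDP` as in the `p`-ordinary case by virtue of [CW24, Thm. 6.2]).
  Finally, when `p = 3` is supersingular for `E` but `a_3` is not necessarily zero, the result follows
  from the analogues of the aforementioned results from [CW24] developed in [CÇSS18, §4]."  With
  **Conjecture 2.4** [p0008 L7–L9] "`Sel_𝔭(K_∞, W)` is `Λ`-cotorsion and `char_Λ(Sel_𝔭(K_∞, W)^∨)Λ_𝒪̂ =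
  (L_p^BDP)`"; §2 [p0008 L2–L6] "For `q ∈ {𝔭, 𝔭̄}` set `Sel_q(K_∞, W) = lim→_n Sel_q(K_n, W)`. As is
  well-known, `Sel_q(K_∞, W)` is a cofinitely generated `Λ`-module"; **Def. 2.1** [p0006 L45–L60,
  p0007 L1–L17] (the `q`-strict Selmer group: `H¹_q(F_w, V) = H¹(F_w, V)` if `w ∣ q`, `0` else, for
  `w ∈ Σ_f`, propagated to `T` and `W`); STANDING SETTING §1.1–§1.2 / §2 [p0001 L44–L52, p0002 L55–L62,
  p0006 L33–L37]: "Let `E/ℚ` be an elliptic curve of conductor `N` and let `p` be an odd prime of good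
  reduction for `E`. … Let `K` be an imaginary quadratic field of discriminant prime to `Np`, and assume
  the classical Heegner hypothesis, i.e., that (Heeg) every prime factor of `N` splits in `K`. … assume
  also that (spl) `p = 𝔭𝔭̄` splits in `K`", "(h0) `E(K)[p] = 0`", "We keep the notation from the
  Introduction, and assume that the triple `(E, K, p)` satisfies hypotheses (Heeg) and (spl)".  NO
  class-number / total-ramification, square-free or ramified-torsion hypothesis is printed for Prop. 2.5
  (contrast Thm. 7.1 (i)–(iv)); "discriminant prime to `Np`" follows from (Heeg) + (spl).
* [CastellaWan2023] accepted MS `paper:url-7157bd4f7b88` (= https://web.math.ucsb.edu/~castella/Perrin-Riou.pdf,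
  re-fetched and re-read by this seat 2026-08-29; journal p = MS p + 2594): **Conjecture 5.2** (MS p. 23
  L52–L58) "The module `X^{rel,str}` is `Λ^ac`-torsion, and `char_{Λac}(X^{rel,str})Λ^ur = (L_p^BDP)` as
  ideals in `Λ^ur`"; **Thm. 6.8** (MS pp. 29 L73 – 30 L14): "(i) Both `Sel_±(K, 𝐓^ac)` and `X_±` have
  `Λ^ac`-rank one, and … `char_{Λac}(X^±_tors) ⊂ char_{Λac}(Sel_±(K, 𝐓^ac)/Λ^ac z^±_∞)²`. (ii) Both
  `Sel^{str,rel}(K, 𝐓^ac)` and `X^{rel,str}` are `Λ^ac`-torsion, and … `char_{Λac}(X^{rel,str})Λ^ur ⊂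
  (L_p^BDP)`. The same result holds for the opposite divisibilities. In particular, Conjectures 4.8 and
  5.2 are equivalent"; §4 standing (MS p. 17 L33–L36) "`E/ℚ` … of conductor `N` … `K` … satisfying
  hypothesis (gen-H) and `p > 3` … of good supersingular reduction"; MS p. 18 L58–L62 "there exists a
  non-negative integer `δ` such that `L_{n+1+δ} = K[p^n]` for `n ≫ 0`, with `δ = 0` when the class
  number of `K` is coprime to `p`" (no class-number hypothesis in §4 / App. A; **Thm. A.4** MS p. 35
  L65–L70, **Cor. 6.4** MS p. 27 L5–L6 likewise); **Thm. A.5** (MS p. 35 L77) "Assume that `N` is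
  squarefree".

READING of the new facts.  Prop. 2.5's `Sel_q(K_∞, W)^∨` (relaxed at `q`, strict at the other places of
`Σ_f`, unramified outside `Σ`) is transcribed on the tree's precomposition dual `AcSelmer.XAc (W⁄K) p κ 𝔮' ∅ γ`
(strict above `𝔮'`, relaxed above the other prime `𝔮` over `p`, strict away from `p`) with `𝔮' = q̄` —
the SAME object and orientation as the Thm. 7.1 / Cor. 7.2 fact above (flags `Shapiro`, `away-p` of the
Castella 2018 / Castella–Wan files: over `K_∞` and for the divisible module `W = E[p^∞]` the unramified
and the strict conditions away from `p` coincide, and the tree's group is contained in the printed one,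
so TORSION of the printed dual implies torsion of the tree's dual).  Prop. 2.5 covers BOTH `q ∈ {𝔭, 𝔭̄}`,
so the orientation flag `CW24-53-orientation-L33` is immaterial for it.

RESTRICTIONS of the new facts (each WEAKER than print).  Prop. 2.5: `5 ≤ p` with `a_p = 0` (print: `p`
odd supersingular, `a_3 = 0` if `p = 3`; the `p = 3` sentence rests on inputs of [CW24] printed for
`p > 3` — not transcribed) -- TODO(general form): `p = 3`, `a_3 = 0` --; `W` globally minimal (to read
`a_p`), `(N : ℤ) = N_E`.  Cor. 7.2 integral: EXACTLY the binders (R1)–(R5) of the rational fact.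

NEW READING FLAG (informational).  `CHKLL-prop25-adaptation`: the supersingular branch of Prop. 2.5 is
proved in print by ONE sentence ("similarly follows from an adaptation of the argument in [CGLS22, Thm.
3.4.1] applied to … [CW24, Thm. A.4] … [CW24, Cor. 6.4] … [CW24, Thm. 6.2]"); the three [CW24] inputs
are printed WITHOUT a class-number or square-free hypothesis (MS locators above; verbatim also in the
tree's `AnticyclotomicSignedHeegnerClasses.lean` module docstring), and [CGLS22] Thm. 3.4.1 / 4.1.1
(Invent. Math. 227 (2022); `paper:arxiv-2008.02571` p0020 L148–L152, p0022 L63–L66: "apply almost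
verbatim in the case when `p` divides the class number of `K`") are refereed.  `CHKLL-cor72-via-CW24-6.8`:
Cor. 7.2's one-line proof is Thm. 7.1 + [CW24, Thm. 6.8] ("Conjectures 4.8 and 5.2 are equivalent").
The source is a refereed journal article (Trans. AMS Ser. B 12 (2025)); typed ≠ proved ≠ endorsed.  (In
the declaration docstrings below the printed word "Conjecture" is rendered "(statement)", as for the
rational fact above: the facts typed are the printed PROPOSITION 2.5 and COROLLARY 7.2, not 2.4 / 5.2
themselves.)
-/

noncomputable section

open scoped NumberField
open NumberField IsDedekindDomain Field
open Literature.NumberTheory.EllipticCurves Literature.NumberTheory.EllipticCurves.ModularForms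
  Literature.NumberTheory.EllipticCurves.Rank1Residual Literature.NumberTheory.EllipticCurves.Castella2018
  Literature.NumberTheory.EllipticCurves.CastellaWan2024 Literature.NumberTheory.GaloisRepresentations

namespace Literature.NumberTheory.EllipticCurves.CastellaHsuKunduLeeLiu2025

/-- **Castella–Hsu–Kundu–Lee–Liu 2025, Thm. 7.1 with Cor. 7.2 (`N⁻ = 1`): the Iwasawa–Greenberg
(BDP) anticyclotomic Iwasawa identity — Castella–Wan's statement 5.2 `char_{Λac}(X^{rel,str})Λ^ur =
(L_p^BDP)` — for `N` square-free with `E[p]` ramified at every `ℓ ∣ N`, at a good supersingular prime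
split in `K`, classical Heegner hypothesis; typed as its EISENSTEIN half UP TO A POWER OF `p`.**
Printed: Thm. 7.1 "Let `(E, K, p)` be a triple as above [§7.1: `p > 2` good supersingular, `a_p = 0`,
`K` imaginary quadratic of discriminant prime to `N`, `p = 𝔭𝔭̄` split, (gen-Heeg)], and assume in
addition that: (i) `N` is square-free. (ii) `E[p]` is ramified at every prime `ℓ ∣ N⁺`. (iii) `E[p]`
is ramified at every prime `ℓ ∣ N⁻` with `ℓ ≡ ±1 (mod p)`. (iv) Every prime above `p` is totally
ramified in `K_∞/K`. Then `𝒮_±` and `𝒳_±` have `Λ`-rank one, and `char_Λ(𝒳_{±,tors}) =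
char_Λ(𝒮_±/(κ^±_∞))²`"; Cor. 7.2 "Let the hypotheses be as in Theorem 7.1. Then [CW24, (statement) 5.2]
holds" (proof: Thm. 7.1 + [CW24, Thm. 6.8]); [CW24] 5.2: "`X^{rel,str}` is `Λ^ac`-torsion, and
`char_{Λac}(X^{rel,str})Λ^ur = (L_p^BDP)`".  TYPED (module docstring, restrictions (R1)–(R6) each
WEAKER than print, flags `CHKLL-inputs`, `tot-ram-via-h_K`, `CW24-53-orientation-L33`): `W/ℚ` globally
minimal elliptic with newform `f` of level `N = N_E`; `5 ≤ p` good with `a_p = 0` (R1); `ρ̄_{E,p}`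
surjective (R3); `K` imaginary quadratic, `p = 𝔭𝔭̄` split with `𝔭` the prime of the embedding datum
`ι`, `𝔭̄ ∋ p`, `𝔭̄ ≠ 𝔭`; EVERY prime `ℓ ∣ N` split in `K` (R2), `(N, D_K) = 1`; `p ∤ h_K` for (iv)
(R5); (i) `Squarefree N` and (ii) "`E[p]` ramified at every prime `q ∣ N`" VERBATIM in the currency of
`BertoliniLongoVenerucci2026.RevisedHypothesis` item (6) (R4); `κ` anticyclotomic with topological
generator `γ`.  CONCLUSION (R6, the currency of the Bertolini–Longo–Venerucci fact and of
`CastellaWan2024.charIdeal_map_le_rat_of_thm53` VERBATIM): a frame `(Ω_K ≠ 0, Ω_p ∈ R₀ˣ,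
L ∈ R₀⟦T⟧)` with `IsCWBDPLFunction ι 𝔭 κ γ f D_K Ω_K Ω_p L` such that along every structure map
`j : ℤ_p → R₀` compatible with `ℤ_p ⊂ ℂ_p` there is `k : ℕ` with `(p^k) · char_Λ(X_ac)·R₀⟦T⟧ ⊆ (L)`,
`X_ac = AcSelmer.XAc (W⁄K) p κ 𝔭̄ ∅ γ` (= `X^{rel,str}`).  A PUBLISHED, refereed theorem (with its own
printed corollary) typed as ONE named fact; no `_holds` expected; consumers take
`(h : thm71_cor72_exists_isCWBDPLFunction_charIdeal_map_le_rat)`.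
-- TODO(general form): the integral equality and the torsion clause of 5.2; the `±` statement of Thm. 7.1; `p = 3`; `N⁻ ≠ 1`.
[cite: CastellaEtAl2025, Thm. 7.1 and Cor. 7.2 (§7.1), Thm. 1.6, §7 opening, Condition CR (arXiv:2308.10474v2 p0029 L3–L51, p0028 L52–L60, p0005 L4–L17)]
[cite: CastellaEtAl2023, Thm. 7.1, Cor. 7.2]
[cite: CastellaWan2023, 5.2 and Def. 5.1 (MS p. 23), Prop. 2.1 and (2.2) (MS pp. 5–8), Thm. 6.8 (MS pp. 29–31)]
[cite: Castella2018, Def. 2.2 (the tree object `AcSelmer.XAc`)] -/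
def thm71_cor72_exists_isCWBDPLFunction_charIdeal_map_le_rat : Prop :=
  ∀ {p : ℕ} [Fact p.Prime] (ι : PadicAlgCl p ≃+* ℂ) (W : WeierstrassCurve ℚ) [W.IsElliptic]
    [W.IsGloballyMinimal] (K : Type) [Field K] [NumberField K]
    (𝔭 𝔭bar : HeightOneSpectrum (𝓞 K)) (κ : ZpExtension K p) (γ : absoluteGaloisGroup K)
    [Fact (κ.IsTopGenerator γ)] {N : ℕ} [NeZero N] {f : CuspForm (CongruenceSubgroup.Gamma0 N) 2}
    (_ : IsNewformOf W f),
    -- the conductor; (R1) `p ≥ 5` good supersingular with `a_p = 0`; (R3) `ρ̄_{E,p}` surjective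
    (N : ℤ) = W.conductorNorm ℤ → 5 ≤ p → W.HasGoodReductionAtPrime p → W.frobeniusTrace p = 0 →
    Surj W p →
    -- `K` imaginary quadratic; `p = 𝔭𝔭̄` split, `𝔭` induced by `ι`
    IsImaginaryQuadratic K → ((Ideal.span {(p : ℤ)}).primesOver (𝓞 K)).ncard = 2 →
      ((p : ℕ) : 𝓞 K) ∈ 𝔭.asIdeal →
      (∀ (w : InfinitePlace K) (k : 𝓞 K), k ∈ 𝔭.asIdeal ↔ ‖ι.symm (w.embedding (k : K))‖ < 1) →
      ((p : ℕ) : 𝓞 K) ∈ 𝔭bar.asIdeal → 𝔭bar ≠ 𝔭 →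
    -- (R2) `N⁻ = 1`: every `ℓ ∣ N` split in `K`; `(N, D_K) = 1`; (R5) `p ∤ h_K` (for (iv))
    (∀ ℓ : ℕ, ℓ.Prime → ℓ ∣ N → ((Ideal.span {(ℓ : ℤ)}).primesOver (𝓞 K)).ncard = 2) →
    IsCoprime (N : ℤ) (NumberField.discr K) → ¬ p ∣ NumberField.classNumber K →
    -- (R4) Thm. 7.1 (i): `N` square-free; (ii): `E[p]` ramified at every prime `q ∣ N = N⁺`
    Squarefree N →
    (∀ q : ℕ, q.Prime → q ∣ N →
      ∃ v : HeightOneSpectrum (𝓞 ℚ), ((q : ℕ) : 𝓞 ℚ) ∈ v.asIdeal ∧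
        ∃ 𝔓 ∈ v.primesAbove, ∃ σ ∈ 𝔓.inertia (absoluteGaloisGroup ℚ),
          ∃ P : W.geomTorsion (p : ℤ), σ • P ≠ P) →
    -- the anticyclotomic tower
    κ.IsAnticyclotomic →
    ∃ (ΩK : ℂ) (Ωp : (unrIntegers p)ˣ) (L : UnrSeries p),
      ΩK ≠ 0 ∧
      IsCWBDPLFunction ι 𝔭 κ γ f (NumberField.discr K) ΩK ((Ωp : unrIntegers p) : ℂ_[p]) L ∧
      ∀ (j : ℤ_[p] →+* unrIntegers p),
        (∀ x : ℤ_[p], ((j x : unrIntegers p) : ℂ_[p]) = algebraMap ℚ_[p] ℂ_[p] (x : ℚ_[p])) →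
        ∃ k : ℕ,
          Ideal.span {PowerSeries.C ((p : unrIntegers p) ^ k)} *
              (AcSelmer.XAc.charIdeal (W.baseChange K) p κ 𝔭bar ∅ γ).map (PowerSeries.map j) ≤
            Ideal.span {L}

/-- Unfolding lemma (the fact is a `∀`-statement; `Iff.rfl`). [cite: CastellaEtAl2025, Thm. 7.1 and Cor. 7.2 (arXiv:2308.10474v2 p0029)] -/
theorem thm71_cor72_exists_isCWBDPLFunction_charIdeal_map_le_rat_iff :
    thm71_cor72_exists_isCWBDPLFunction_charIdeal_map_le_rat ↔
    ∀ {p : ℕ} [Fact p.Prime] (ι : PadicAlgCl p ≃+* ℂ) (W : WeierstrassCurve ℚ) [W.IsElliptic]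
      [W.IsGloballyMinimal] (K : Type) [Field K] [NumberField K]
      (𝔭 𝔭bar : HeightOneSpectrum (𝓞 K)) (κ : ZpExtension K p) (γ : absoluteGaloisGroup K)
      [Fact (κ.IsTopGenerator γ)] {N : ℕ} [NeZero N] {f : CuspForm (CongruenceSubgroup.Gamma0 N) 2}
      (_ : IsNewformOf W f),
      (N : ℤ) = W.conductorNorm ℤ → 5 ≤ p → W.HasGoodReductionAtPrime p → W.frobeniusTrace p = 0 →
      Surj W p →
      IsImaginaryQuadratic K → ((Ideal.span {(p : ℤ)}).primesOver (𝓞 K)).ncard = 2 →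
        ((p : ℕ) : 𝓞 K) ∈ 𝔭.asIdeal →
        (∀ (w : InfinitePlace K) (k : 𝓞 K), k ∈ 𝔭.asIdeal ↔ ‖ι.symm (w.embedding (k : K))‖ < 1) →
        ((p : ℕ) : 𝓞 K) ∈ 𝔭bar.asIdeal → 𝔭bar ≠ 𝔭 →
      (∀ ℓ : ℕ, ℓ.Prime → ℓ ∣ N → ((Ideal.span {(ℓ : ℤ)}).primesOver (𝓞 K)).ncard = 2) →
      IsCoprime (N : ℤ) (NumberField.discr K) → ¬ p ∣ NumberField.classNumber K →
      Squarefree N →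
      (∀ q : ℕ, q.Prime → q ∣ N →
        ∃ v : HeightOneSpectrum (𝓞 ℚ), ((q : ℕ) : 𝓞 ℚ) ∈ v.asIdeal ∧
          ∃ 𝔓 ∈ v.primesAbove, ∃ σ ∈ 𝔓.inertia (absoluteGaloisGroup ℚ),
            ∃ P : W.geomTorsion (p : ℤ), σ • P ≠ P) →
      κ.IsAnticyclotomic →
      ∃ (ΩK : ℂ) (Ωp : (unrIntegers p)ˣ) (L : UnrSeries p),
        ΩK ≠ 0 ∧
        IsCWBDPLFunction ι 𝔭 κ γ f (NumberField.discr K) ΩK ((Ωp : unrIntegers p) : ℂ_[p]) L ∧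
        ∀ (j : ℤ_[p] →+* unrIntegers p),
          (∀ x : ℤ_[p], ((j x : unrIntegers p) : ℂ_[p]) = algebraMap ℚ_[p] ℂ_[p] (x : ℚ_[p])) →
          ∃ k : ℕ,
            Ideal.span {PowerSeries.C ((p : unrIntegers p) ^ k)} *
                (AcSelmer.XAc.charIdeal (W.baseChange K) p κ 𝔭bar ∅ γ).map (PowerSeries.map j) ≤
              Ideal.span {L} :=
  Iff.rfl

-- `DecidableEq K` for the group law on `E(K)` in (h0) (as `HeegnerPointsKolyvaginTorsionProofs.lean`,
-- `KubertTate1314Torsion.lean`)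
open scoped Classical in
/-- **Castella–Hsu–Kundu–Lee–Liu 2025, Prop. 2.5 (supersingular branch): `X_q = Sel_q(K_∞, W)^∨` is
`Λ`-torsion under (h0).**  Printed [arXiv:2308.10474v2 p0008 L17–L28]: "The first claim in (statement)
2.4 is now known under a mild hypothesis.  Proposition 2.5. Assume (h0). Then `Sel_q(K_∞, W)` is
`Λ`-cotorsion.  Proof. In the `p`-ordinary case, this follows from [CGLS22, Thm. 4.2.2] and [CGS23,
Thm. 5.53]. … For supersingular primes `p` (and assuming `a_p = 0` when `p = 3`), the result similarly
follows from an adaptation of the argument in [CGLS22, Thm. 3.4.1] applied to (signed) Heegner point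
Kolyvagin system constructed in [CW24, Thm. A.4] (which is non-trivial by [CW24, Cor. 6.4] and in a
similar relation to `L_q^BDP` as in the `p`-ordinary case by virtue of [CW24, Thm. 6.2])."  Standing
setting of §1–§2 [p0001 L44–L52, p0002 L55–L62, p0006 L33–L37]: `E/ℚ` of conductor `N`, `p > 2` good,
`K` imaginary quadratic with (Heeg) "every prime factor of `N` splits in `K`" and (spl) "`p = 𝔭𝔭̄`
splits in `K`", (h0) "`E(K)[p] = 0`", `q ∈ {𝔭, 𝔭̄}` (Def. 2.1: the `q`-strict Selmer group; §2 p0008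
L2–L6: `Sel_q(K_∞, W) = lim→ Sel_q(K_n, W)`, cofinitely generated over `Λ`).  NO class-number /
total-ramification, square-free or ramified-torsion hypothesis is printed for Prop. 2.5 (contrast Thm.
7.1 (i)–(iv)).  TYPED (module docstring ADDENDUM; restrictions, each WEAKER than print): `W/ℚ` globally
minimal elliptic of conductor `N`; `5 ≤ p` good with `a_p = 0` (the supersingular branch only;
-- TODO(general form): `p = 3`, `a_3 = 0`); `K` imaginary quadratic; `p` split with `𝔮 ≠ 𝔮'` the two
primes above `p` in EITHER order (Prop. 2.5 covers both `q`, so the orientation flag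
`CW24-53-orientation-L33` is immaterial here); (Heeg) as "every `ℓ ∣ N` has two primes of `K` above
it"; (h0) as `AddSubgroup.torsionBy (E(K)) p = ⊥`; `κ` the anticyclotomic `ℤ_p`-extension with
topological generator `γ`.  CONCLUSION in the currency of this file's Thm. 7.1 / Cor. 7.2 fact: the
precomposition dual `X = AcSelmer.XAc (W⁄K) p κ 𝔮' ∅ γ` (strict at `𝔮' ∋ p`, i.e. `q = 𝔮`) is a
torsion `Λ`-module (a quotient of the printed `Sel_q(K_∞, W)^∨`, flags `Shapiro`, `away-p`).  A
PUBLISHED, refereed proposition (Trans. AMS Ser. B 12 (2025)); its supersingular proof is ONE printed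
sentence of "adaptation" (flag `CHKLL-prop25-adaptation`, informational).  Consumers take
`(h : prop25_XAc_isTorsion)` — e.g. the crux glue `TS1Shape.xAcTorsionSS_classDvd_of_prop25 h`, which
discharges (h0) from `Surj` by `torsionBy_eq_bot_of_isImaginaryQuadratic`; no `_holds` expected.
[cite: CastellaEtAl2025, Prop. 2.5, (statement) 2.4, Def. 2.1, (h0), §2 setting (arXiv:2308.10474v2 p0008 L2–L28, p0006 L33–L60, p0002 L55–L62)]
[cite: CastellaWan2023, Thm. A.4, Cor. 6.4, Thm. 6.2 (MS pp. 35, 27, 25)] [cite: Castella2018, Def. 2.2 (the tree object `AcSelmer.XAc`)] -/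
def prop25_XAc_isTorsion : Prop :=
  ∀ {p : ℕ} [Fact p.Prime] (W : WeierstrassCurve ℚ) [W.IsElliptic] [W.IsGloballyMinimal]
    (K : Type) [Field K] [NumberField K] (𝔮 𝔮' : HeightOneSpectrum (𝓞 K))
    (κ : ZpExtension K p) (γ : absoluteGaloisGroup K) [Fact (κ.IsTopGenerator γ)] (N : ℕ) [NeZero N],
    -- the conductor; `p ≥ 5` good supersingular with `a_p = 0`
    (N : ℤ) = W.conductorNorm ℤ → 5 ≤ p → W.HasGoodReductionAtPrime p → W.frobeniusTrace p = 0 →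
    -- `K` imaginary quadratic; (spl) `p` split, `𝔮 ≠ 𝔮'` the two primes above `p`
    IsImaginaryQuadratic K → ((Ideal.span {(p : ℤ)}).primesOver (𝓞 K)).ncard = 2 →
      ((p : ℕ) : 𝓞 K) ∈ 𝔮.asIdeal → ((p : ℕ) : 𝓞 K) ∈ 𝔮'.asIdeal → 𝔮' ≠ 𝔮 →
    -- (Heeg) every `ℓ ∣ N` split in `K`
    (∀ ℓ : ℕ, ℓ.Prime → ℓ ∣ N → ((Ideal.span {(ℓ : ℤ)}).primesOver (𝓞 K)).ncard = 2) →
    -- (h0) `E(K)[p] = 0`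
    AddSubgroup.torsionBy (W.baseChange K).toAffine.Point (p : ℤ) = ⊥ →
    -- the anticyclotomic tower
    κ.IsAnticyclotomic →
    Module.IsTorsion (IwasawaAlgebra p) (AcSelmer.XAc (W.baseChange K) p κ 𝔮' ∅ γ)

open scoped Classical in
/-- Unfolding lemma (the fact is a `∀`-statement; `Iff.rfl`). [cite: CastellaEtAl2025, Prop. 2.5 (arXiv:2308.10474v2 p0008 L17–L28)] -/
theorem prop25_XAc_isTorsion_iff :
    prop25_XAc_isTorsion ↔
    ∀ {p : ℕ} [Fact p.Prime] (W : WeierstrassCurve ℚ) [W.IsElliptic] [W.IsGloballyMinimal]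
      (K : Type) [Field K] [NumberField K] (𝔮 𝔮' : HeightOneSpectrum (𝓞 K))
      (κ : ZpExtension K p) (γ : absoluteGaloisGroup K) [Fact (κ.IsTopGenerator γ)] (N : ℕ) [NeZero N],
      (N : ℤ) = W.conductorNorm ℤ → 5 ≤ p → W.HasGoodReductionAtPrime p → W.frobeniusTrace p = 0 →
      IsImaginaryQuadratic K → ((Ideal.span {(p : ℤ)}).primesOver (𝓞 K)).ncard = 2 →
        ((p : ℕ) : 𝓞 K) ∈ 𝔮.asIdeal → ((p : ℕ) : 𝓞 K) ∈ 𝔮'.asIdeal → 𝔮' ≠ 𝔮 →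
      (∀ ℓ : ℕ, ℓ.Prime → ℓ ∣ N → ((Ideal.span {(ℓ : ℤ)}).primesOver (𝓞 K)).ncard = 2) →
      AddSubgroup.torsionBy (W.baseChange K).toAffine.Point (p : ℤ) = ⊥ →
      κ.IsAnticyclotomic →
      Module.IsTorsion (IwasawaAlgebra p) (AcSelmer.XAc (W.baseChange K) p κ 𝔮' ∅ γ) :=
  Iff.rfl

/-- **Castella–Hsu–Kundu–Lee–Liu 2025, Thm. 7.1 with Cor. 7.2 (`N⁻ = 1`), INTEGRAL form = Castella–Wan's
(statement) 5.2 IN FULL on the cell of Thm. 7.1: `X^{rel,str}` is `Λ^ac`-torsion and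
`char_{Λac}(X^{rel,str})Λ^ur = (L_p^BDP)`** — the content of this file's `-- TODO(general form): the
integral equality and the torsion clause of 5.2`.  Printed [p0029 L28–L42]: Thm. 7.1 (i)–(iv) (quoted
at the rational fact) and "Corollary 7.2. Let the hypotheses be as in Theorem 7.1. Then [CW24, (statement)
5.2] holds. In particular, in the case `N⁻ = 1`, (statement) 2.4 in the body of the paper holds. Proof.
This follows from Theorem 7.1 and the equivalence in [CW24, Thm. 6.8], noting that (statement) 2.4 is
the same as [CW24, (statement) 5.2] when `N⁻ = 1`"; [CW24] (statement) 5.2 (MS p. 23): "The module `X^{rel,str}`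
is `Λ^ac`-torsion, and `char_{Λac}(X^{rel,str})Λ^ur = (L_p^BDP)` as ideals in `Λ^ur`"; [CW24, Thm. 6.8]
(MS pp. 29–30): "… In particular, (statements) 4.8 and 5.2 are equivalent" (wording convention of
the module docstring ADDENDUM).  TYPED with EXACTLY the
binders (R1)–(R5) of `thm71_cor72_exists_isCWBDPLFunction_charIdeal_map_le_rat` (same order, same
currency; module docstring); CONCLUSION: `X_ac = AcSelmer.XAc (W⁄K) p κ 𝔭̄ ∅ γ` is `Λ`-torsion AND there
is a Castella–Wan frame `(Ω_K ≠ 0, Ω_p ∈ R₀ˣ, L)` with `IsCWBDPLFunction ι 𝔭 κ γ f D_K Ω_K Ω_p L` such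
that along every structure map `j : ℤ_p → R₀` compatible with `ℤ_p ⊂ ℂ_p` the INTEGRAL EQUALITY
`char_Λ(X_ac)·R₀⟦T⟧ = (L)` holds (the frame absorbs the unit `u` of `L = ι_Λ(u · L_p^BDP)`, flags
`CW24-53-orientation-L33`, `heegner-normalisation`, `CHKLL-cor72-via-CW24-6.8`).  Refines the `_rat`
fact (`thm71_cor72_le_rat_of_eq`, `k = 0`).  A PUBLISHED, refereed theorem with its printed corollary;
consumers take `(h : thm71_cor72_isTorsion_charIdeal_map_eq)`; no `_holds` expected.
-- TODO(general form): the `±` statement of Thm. 7.1 (`AcSigned` currency); `p = 3`; `N⁻ ≠ 1`.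
[cite: CastellaEtAl2025, Thm. 7.1 and Cor. 7.2 (§7.1) (arXiv:2308.10474v2 p0029 L28–L42)]
[cite: CastellaWan2023, 5.2 and Def. 5.1 (MS p. 23), Prop. 2.1 and (2.2) (MS pp. 5–8), Thm. 6.8 (MS pp. 29–30)]
[cite: Castella2018, Def. 2.2 (the tree object `AcSelmer.XAc`)] -/
def thm71_cor72_isTorsion_charIdeal_map_eq : Prop :=
  ∀ {p : ℕ} [Fact p.Prime] (ι : PadicAlgCl p ≃+* ℂ) (W : WeierstrassCurve ℚ) [W.IsElliptic]
    [W.IsGloballyMinimal] (K : Type) [Field K] [NumberField K]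
    (𝔭 𝔭bar : HeightOneSpectrum (𝓞 K)) (κ : ZpExtension K p) (γ : absoluteGaloisGroup K)
    [Fact (κ.IsTopGenerator γ)] {N : ℕ} [NeZero N] {f : CuspForm (CongruenceSubgroup.Gamma0 N) 2}
    (_ : IsNewformOf W f),
    -- the conductor; (R1) `p ≥ 5` good supersingular with `a_p = 0`; (R3) `ρ̄_{E,p}` surjective
    (N : ℤ) = W.conductorNorm ℤ → 5 ≤ p → W.HasGoodReductionAtPrime p → W.frobeniusTrace p = 0 →
    Surj W p →
    -- `K` imaginary quadratic; `p = 𝔭𝔭̄` split, `𝔭` induced by `ι`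
    IsImaginaryQuadratic K → ((Ideal.span {(p : ℤ)}).primesOver (𝓞 K)).ncard = 2 →
      ((p : ℕ) : 𝓞 K) ∈ 𝔭.asIdeal →
      (∀ (w : InfinitePlace K) (k : 𝓞 K), k ∈ 𝔭.asIdeal ↔ ‖ι.symm (w.embedding (k : K))‖ < 1) →
      ((p : ℕ) : 𝓞 K) ∈ 𝔭bar.asIdeal → 𝔭bar ≠ 𝔭 →
    -- (R2) `N⁻ = 1`: every `ℓ ∣ N` split in `K`; `(N, D_K) = 1`; (R5) `p ∤ h_K` (for (iv))
    (∀ ℓ : ℕ, ℓ.Prime → ℓ ∣ N → ((Ideal.span {(ℓ : ℤ)}).primesOver (𝓞 K)).ncard = 2) →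
    IsCoprime (N : ℤ) (NumberField.discr K) → ¬ p ∣ NumberField.classNumber K →
    -- (R4) Thm. 7.1 (i): `N` square-free; (ii): `E[p]` ramified at every prime `q ∣ N = N⁺`
    Squarefree N →
    (∀ q : ℕ, q.Prime → q ∣ N →
      ∃ v : HeightOneSpectrum (𝓞 ℚ), ((q : ℕ) : 𝓞 ℚ) ∈ v.asIdeal ∧
        ∃ 𝔓 ∈ v.primesAbove, ∃ σ ∈ 𝔓.inertia (absoluteGaloisGroup ℚ),
          ∃ P : W.geomTorsion (p : ℤ), σ • P ≠ P) →
    -- the anticyclotomic tower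
    κ.IsAnticyclotomic →
    Module.IsTorsion (IwasawaAlgebra p) (AcSelmer.XAc (W.baseChange K) p κ 𝔭bar ∅ γ) ∧
    ∃ (ΩK : ℂ) (Ωp : (unrIntegers p)ˣ) (L : UnrSeries p),
      ΩK ≠ 0 ∧
      IsCWBDPLFunction ι 𝔭 κ γ f (NumberField.discr K) ΩK ((Ωp : unrIntegers p) : ℂ_[p]) L ∧
      ∀ (j : ℤ_[p] →+* unrIntegers p),
        (∀ x : ℤ_[p], ((j x : unrIntegers p) : ℂ_[p]) = algebraMap ℚ_[p] ℂ_[p] (x : ℚ_[p])) →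
        (AcSelmer.XAc.charIdeal (W.baseChange K) p κ 𝔭bar ∅ γ).map (PowerSeries.map j) =
          Ideal.span {L}

/-- Unfolding lemma (the fact is a `∀`-statement; `Iff.rfl`). [cite: CastellaEtAl2025, Thm. 7.1 and Cor. 7.2 (arXiv:2308.10474v2 p0029 L28–L42)] -/
theorem thm71_cor72_isTorsion_charIdeal_map_eq_iff :
    thm71_cor72_isTorsion_charIdeal_map_eq ↔
    ∀ {p : ℕ} [Fact p.Prime] (ι : PadicAlgCl p ≃+* ℂ) (W : WeierstrassCurve ℚ) [W.IsElliptic]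
      [W.IsGloballyMinimal] (K : Type) [Field K] [NumberField K]
      (𝔭 𝔭bar : HeightOneSpectrum (𝓞 K)) (κ : ZpExtension K p) (γ : absoluteGaloisGroup K)
      [Fact (κ.IsTopGenerator γ)] {N : ℕ} [NeZero N] {f : CuspForm (CongruenceSubgroup.Gamma0 N) 2}
      (_ : IsNewformOf W f),
      (N : ℤ) = W.conductorNorm ℤ → 5 ≤ p → W.HasGoodReductionAtPrime p → W.frobeniusTrace p = 0 →
      Surj W p →
      IsImaginaryQuadratic K → ((Ideal.span {(p : ℤ)}).primesOver (𝓞 K)).ncard = 2 →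
        ((p : ℕ) : 𝓞 K) ∈ 𝔭.asIdeal →
        (∀ (w : InfinitePlace K) (k : 𝓞 K), k ∈ 𝔭.asIdeal ↔ ‖ι.symm (w.embedding (k : K))‖ < 1) →
        ((p : ℕ) : 𝓞 K) ∈ 𝔭bar.asIdeal → 𝔭bar ≠ 𝔭 →
      (∀ ℓ : ℕ, ℓ.Prime → ℓ ∣ N → ((Ideal.span {(ℓ : ℤ)}).primesOver (𝓞 K)).ncard = 2) →
      IsCoprime (N : ℤ) (NumberField.discr K) → ¬ p ∣ NumberField.classNumber K →
      Squarefree N →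
      (∀ q : ℕ, q.Prime → q ∣ N →
        ∃ v : HeightOneSpectrum (𝓞 ℚ), ((q : ℕ) : 𝓞 ℚ) ∈ v.asIdeal ∧
          ∃ 𝔓 ∈ v.primesAbove, ∃ σ ∈ 𝔓.inertia (absoluteGaloisGroup ℚ),
            ∃ P : W.geomTorsion (p : ℤ), σ • P ≠ P) →
      κ.IsAnticyclotomic →
      Module.IsTorsion (IwasawaAlgebra p) (AcSelmer.XAc (W.baseChange K) p κ 𝔭bar ∅ γ) ∧
      ∃ (ΩK : ℂ) (Ωp : (unrIntegers p)ˣ) (L : UnrSeries p),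
        ΩK ≠ 0 ∧
        IsCWBDPLFunction ι 𝔭 κ γ f (NumberField.discr K) ΩK ((Ωp : unrIntegers p) : ℂ_[p]) L ∧
        ∀ (j : ℤ_[p] →+* unrIntegers p),
          (∀ x : ℤ_[p], ((j x : unrIntegers p) : ℂ_[p]) = algebraMap ℚ_[p] ℂ_[p] (x : ℚ_[p])) →
          (AcSelmer.XAc.charIdeal (W.baseChange K) p κ 𝔭bar ∅ γ).map (PowerSeries.map j) =
            Ideal.span {L} :=
  Iff.rfl

/-- **The integral Cor. 7.2 fact refines the rational Thm. 7.1 / Cor. 7.2 fact** (take `k = 0`: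
`(p^0) · char·R₀⟦T⟧ = char·R₀⟦T⟧ ≤ (L)` from the equality).  So every consumer of
`thm71_cor72_exists_isCWBDPLFunction_charIdeal_map_le_rat` is served by
`thm71_cor72_isTorsion_charIdeal_map_eq` as well. [cite: CastellaEtAl2025, Thm. 7.1 and Cor. 7.2 (arXiv:2308.10474v2 p0029 L28–L42)] -/
theorem thm71_cor72_le_rat_of_eq (h : thm71_cor72_isTorsion_charIdeal_map_eq) :
    thm71_cor72_exists_isCWBDPLFunction_charIdeal_map_le_rat := by
  intro p _ ι W _ _ K _ _ 𝔭 𝔭bar κ γ _ N _ f hf hN hp hgood ha0 hs hK hsplit h𝔭 hι h𝔭bar hne hHeeg hcop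
    hh hsqf hram hκ
  obtain ⟨-, ΩK, Ωp, L, hΩK, hL, hEq⟩ :=
    h ι W K 𝔭 𝔭bar κ γ hf hN hp hgood ha0 hs hK hsplit h𝔭 hι h𝔭bar hne hHeeg hcop hh hsqf hram hκ
  refine ⟨ΩK, Ωp, L, hΩK, hL, fun j hj ↦ ⟨0, ?_⟩⟩
  rw [pow_zero, map_one, Ideal.span_singleton_one, Ideal.top_mul]
  exact (hEq j hj).le

end Literature.NumberTheory.EllipticCurves.CastellaHsuKunduLeeLiu2025

end
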